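import Summits.AnomalousDissipation.AnomalousDissipation.Theses.MirrorEnsemble
import Summits.AnomalousDissipation.AnomalousDissipation.Theorems.TaylorGreenLoudGalerkinStates.Negative.Anatomy
import Summits.AnomalousDissipation.AnomalousDissipation.Theorems.GPStatisticalRigidity.Negative.IntegrableRedundant
import Literature.Analysis.FluidPDE.SteadyNavierStokesEnergy
import Literature.Analysis.FluidPDE.StatisticalSolutionProofs

/-!
# Load-bearing hypotheses, redundancies and the steady-state kill switch of
# `MirrorEnsemble.MirrorStatisticsLoudTG` (stmt-AnomalousDissipation-17693) — negative side

Crux attack at birth, seat `refuter-rattack-stmt-AnomalousDissipation-17693-0` (2026-08-17). Kernel-checked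
negative knowledge about the crux L_K = BOUNDED MIRROR STATISTICS ARE LOUD; nothing here asserts a Theses
statement.

* `mirrorClass`, `LoudAt E ε₀ ν₀` — the mirror class `Fix K` and the `∀ ν ∀ μ` body of the crux, verbatim;
  `crux_iff` strips the sugar binder `∀ f, f = f_TG →`.
* `loudAt_anti`, `loudAt_of_neg` — constants for level `E` serve every `E' ≤ E`; negative levels are vacuous.
* `loudAtNoInt_iff` — the clause `Integrable ‖v‖²` is REDUNDANT: it follows from the finite mean enstrophy of a
  stationary statistical solution (FMRT IV (1.29)) by Poincaré on the mean-zero space `H`.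
* `eps_le_half_sqrt_of_loudAt` — CONSTANTS WINDOW: as soon as the hypothesis class at level `E` is inhabited for
  some `ν < ν₀`, the floor obeys `ε₀ ≤ ½ √E` (energy inequality + Cauchy–Schwarz, `‖f_TG‖ = ½`).
* `mirrorStatisticsLoudTG_false_without_sss` — with the stationary-statistical-solution clause deleted (keeping
  probability, integrable energy, the level and the mirror support) the Dirac mass AT REST kills the statement:
  any proof must use the Liouville/energy clauses of FMRT Def. 1.3, not just normalisation + symmetry.
* `not_mirrorStatisticsLoudTG_of_quietSteadyStates` — KILL SWITCH: one sequence of mirror-symmetric steady weak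
  solutions `uₙ ∈ V` of NS_{νₙ}(f_TG), `νₙ → 0`, with `‖uₙ‖² ≤ E` and `νₙ‖∇uₙ‖² → 0` refutes the crux (Dirac
  masses are K-supported stationary statistical solutions, FMRT IV §1.2). The in-tree Newton census of steady
  K-branches (E ~ ν^{-0.7}, νW ≈ 0.25) does not provide one.
-/

noncomputable section

open MeasureTheory UnitAddTorus Filter
open scoped InnerProductSpace ENNReal Topology

set_option linter.dupNamespace false

namespace Summit.AnomalousDissipation.AnomalousDissipation.Theorems.MirrorStatisticsLoudTG.Negative

open Literature.Analysis.FunctionSpaces Literature.Analysis.FunctionSpaces.Torus Literature.Analysis.FluidPDE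
open Summit.AnomalousDissipation.AnomalousDissipation.Theses.MirrorEnsemble
open Summit.AnomalousDissipation.AnomalousDissipation.Theorems.TaylorGreenLoudGalerkinStates.Negative
  (tgForce isSmooth_tgForce integral_norm_sq_tgForce)
open Summit.AnomalousDissipation.AnomalousDissipation.Theorems.GPStatisticalRigidity.Negative
  (integrable_norm_sq_of_ensembleEnstrophy_lt_top ensembleEnergy_nonneg)

/-! ## §1 The mirror class and the body of the crux -/

/-- The mirror class `Fix K ⊆ H`: `v_{i'}(R_i x) = ∓ v_{i'}(x)` a.e. under the three coordinate reflections
`R_i x = update x i (−x i)` (verbatim the crux's set). -/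
def mirrorClass : Set (Torus.energySpace (Fin 3)) :=
  {v : Torus.energySpace (Fin 3) | ∀ i i' : Fin 3,
    (fun x => ((v : Lp (EuclideanSpace ℝ (Fin 3)) 2 (volume : Measure (UnitAddTorus (Fin 3)))) :
      UnitAddTorus (Fin 3) → EuclideanSpace ℝ (Fin 3)) (Function.update x i (-x i)) i') =ᵐ[volume]
    (fun x => if i' = i then
      -(((v : Lp (EuclideanSpace ℝ (Fin 3)) 2 (volume : Measure (UnitAddTorus (Fin 3)))) :
        UnitAddTorus (Fin 3) → EuclideanSpace ℝ (Fin 3)) x i')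
      else ((v : Lp (EuclideanSpace ℝ (Fin 3)) 2 (volume : Measure (UnitAddTorus (Fin 3)))) :
        UnitAddTorus (Fin 3) → EuclideanSpace ℝ (Fin 3)) x i')}

/-- The `∀ ν ∀ μ` body of the crux at level `E` with constants `ε₀, ν₀`. -/
def LoudAt (E ε₀ ν₀ : ℝ) : Prop :=
  ∀ ν : ℝ, 0 < ν → ν < ν₀ → ∀ μ : Measure (Torus.energySpace (Fin 3)),
    Torus.IsStationaryStatisticalSolution ν tgForce μ →
      Integrable (fun v : Torus.energySpace (Fin 3) => ‖v‖ ^ 2) μ → Torus.ensembleEnergy μ ≤ E →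
        μ (closure mirrorClass)ᶜ = 0 → ε₀ ≤ Torus.ensembleDissipation ν μ

/-- The crux, unfolded: the binder `∀ f, f = f_TG →` is sugar. -/
theorem crux_iff : MirrorStatisticsLoudTG ↔ ∀ E : ℝ, ∃ ε₀ ν₀ : ℝ, 0 < ε₀ ∧ 0 < ν₀ ∧ LoudAt E ε₀ ν₀ := by
  constructor
  · intro h E
    obtain ⟨ε₀, ν₀, hε, hν, hl⟩ := h tgForce rfl E
    exact ⟨ε₀, ν₀, hε, hν, fun ν hν0 hν1 μ hμ hI hE hS => hl ν hν0 hν1 μ hμ hI hE hS⟩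
  · intro h f hf E
    subst hf
    obtain ⟨ε₀, ν₀, hε, hν, hl⟩ := h E
    exact ⟨ε₀, ν₀, hε, hν, fun ν hν0 hν1 μ hμ hI hE hS => hl ν hν0 hν1 μ hμ hI hE hS⟩

/-! ## §2 Level bookkeeping -/

/-- Constants valid at level `E` are valid at every lower level. -/
theorem loudAt_anti {E E' ε₀ ν₀ : ℝ} (hEE' : E' ≤ E) (h : LoudAt E ε₀ ν₀) : LoudAt E' ε₀ ν₀ :=
  fun ν hν0 hν1 μ hμ hI hE hS => h ν hν0 hν1 μ hμ hI (hE.trans hEE') hS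

/-- Negative levels are vacuous (any constants work): `e(μ) ≥ 0`. -/
theorem loudAt_of_neg {E : ℝ} (hE : E < 0) (ε₀ ν₀ : ℝ) : LoudAt E ε₀ ν₀ :=
  fun _ _ _ μ _ _ hEμ _ => absurd (hEμ.trans_lt hE) (not_lt.mpr (ensembleEnergy_nonneg μ))

/-! ## §3 The integrability clause is redundant -/

/-- The body with the hypothesis `Integrable ‖v‖²` DELETED. -/
def LoudAtNoInt (E ε₀ ν₀ : ℝ) : Prop :=
  ∀ ν : ℝ, 0 < ν → ν < ν₀ → ∀ μ : Measure (Torus.energySpace (Fin 3)),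
    Torus.IsStationaryStatisticalSolution ν tgForce μ → Torus.ensembleEnergy μ ≤ E →
      μ (closure mirrorClass)ᶜ = 0 → ε₀ ≤ Torus.ensembleDissipation ν μ

/-- **The energy-integrability hypothesis is redundant** (finite mean enstrophy + Poincaré on `H`). -/
theorem loudAtNoInt_iff (E ε₀ ν₀ : ℝ) : LoudAtNoInt E ε₀ ν₀ ↔ LoudAt E ε₀ ν₀ := by
  constructor
  · exact fun h ν hν0 hν1 μ hμ _ hE hS => h ν hν0 hν1 μ hμ hE hS
  · intro h ν hν0 hν1 μ hμ hE hS
    haveI := hμ.prob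
    exact h ν hν0 hν1 μ hμ (integrable_norm_sq_of_ensembleEnstrophy_lt_top μ hμ.enstrophy_finite) hE hS

/-! ## §4 Constants window -/

/-- `f_TG ∈ L²`. -/
theorem memLp_tgForce : MemLp tgForce 2 volume := isSmooth_tgForce.memLp 2

/-- DISSIPATION CEILING at the pinned force: every stationary statistical solution of NS_ν(f_TG) with
integrable energy has `ε(μ) ≤ ½ √e(μ)` (`‖f_TG‖_{L²} = ½`). -/
theorem ensembleDissipation_le_half_sqrt {ν : ℝ} {μ : Measure (Torus.energySpace (Fin 3))}
    (hμ : Torus.IsStationaryStatisticalSolution ν tgForce μ)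
    (hI : Integrable (fun v : Torus.energySpace (Fin 3) => ‖v‖ ^ 2) μ) :
    Torus.ensembleDissipation ν μ ≤ 2⁻¹ * Real.sqrt (Torus.ensembleEnergy μ) := by
  have h := Torus.ensembleDissipation_le_of_isStationary_holds hμ memLp_tgForce hI
  have hf : Real.sqrt (∫ x, ‖tgForce x‖ ^ 2) = 2⁻¹ := by
    rw [integral_norm_sq_tgForce]
    rw [show (4⁻¹ : ℝ) = 2⁻¹ ^ 2 by norm_num, Real.sqrt_sq (by norm_num)]
  rwa [hf] at h

/-- **Constants window.** If the hypothesis class at level `E` is inhabited at some admissible viscosity, the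
floor constant obeys `ε₀ ≤ ½ √E`. -/
theorem eps_le_half_sqrt_of_loudAt {E ε₀ ν₀ : ℝ} (h : LoudAt E ε₀ ν₀)
    (hex : ∃ ν : ℝ, 0 < ν ∧ ν < ν₀ ∧ ∃ μ : Measure (Torus.energySpace (Fin 3)),
      Torus.IsStationaryStatisticalSolution ν tgForce μ ∧ Torus.ensembleEnergy μ ≤ E ∧
        μ (closure mirrorClass)ᶜ = 0) :
    ε₀ ≤ 2⁻¹ * Real.sqrt E := by
  obtain ⟨ν, hν0, hν1, μ, hμ, hE, hS⟩ := hex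
  haveI := hμ.prob
  have hI := integrable_norm_sq_of_ensembleEnstrophy_lt_top μ hμ.enstrophy_finite
  calc ε₀ ≤ Torus.ensembleDissipation ν μ := h ν hν0 hν1 μ hμ hI hE hS
    _ ≤ 2⁻¹ * Real.sqrt (Torus.ensembleEnergy μ) := ensembleDissipation_le_half_sqrt hμ hI
    _ ≤ 2⁻¹ * Real.sqrt E := by gcongr

/-! ## §5 Load-bearing: the stationary-statistical-solution clause -/

/-- The coordinate reflection `R_i` preserves Haar measure on `T³`. -/
theorem measurePreserving_reflect (i : Fin 3) :
    MeasurePreserving (fun x : UnitAddTorus (Fin 3) => Function.update x i (-x i)) volume volume := by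
  haveI : (volume : Measure UnitAddCircle).IsNegInvariant :=
    Measure.IsAddHaarMeasure.isNegInvariant_of_regular _
  have hf : ∀ j : Fin 3, MeasurePreserving
      ((if j = i then (fun t : UnitAddCircle => -t) else id) : UnitAddCircle → UnitAddCircle) volume volume := by
    intro j
    split_ifs
    · exact Measure.measurePreserving_neg (volume : Measure UnitAddCircle)
    · exact MeasurePreserving.id volume
  have h := volume_preserving_pi (α' := fun _ : Fin 3 => UnitAddCircle) (β' := fun _ : Fin 3 => UnitAddCircle) hf
  have hfun : (fun x : UnitAddTorus (Fin 3) => Function.update x i (-x i)) =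
      fun (x : UnitAddTorus (Fin 3)) (j : Fin 3) =>
        (if j = i then (fun t : UnitAddCircle => -t) else id) (x j) := by
    funext x j
    by_cases hj : j = i
    · subst hj
      simp
    · simp [hj]
  rw [hfun]
  exact h

/-- The state of rest is mirror symmetric (Mathlib's `AEEqFun.cast` represents the zero class by the zero
function, so the identity even holds pointwise). -/
theorem zero_mem_mirrorClass : (0 : Torus.energySpace (Fin 3)) ∈ mirrorClass :=
  fun _ _ => ae_of_all _ fun x => by simp

/-- The crux with the clause `IsStationaryStatisticalSolution ν f_TG μ` DELETED (probability normalisation,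
integrable energy, the level and the mirror support kept). -/
def MirrorStatisticsLoudTGWithoutSSS : Prop :=
  ∀ E : ℝ, ∃ ε₀ ν₀ : ℝ, 0 < ε₀ ∧ 0 < ν₀ ∧ ∀ ν : ℝ, 0 < ν → ν < ν₀ →
    ∀ μ : Measure (Torus.energySpace (Fin 3)), IsProbabilityMeasure μ →
      Integrable (fun v : Torus.energySpace (Fin 3) => ‖v‖ ^ 2) μ → Torus.ensembleEnergy μ ≤ E →
        μ (closure mirrorClass)ᶜ = 0 → ε₀ ≤ Torus.ensembleDissipation ν μ

/-- The Dirac mass at rest is carried by the (closure of the) mirror class. -/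
theorem dirac_zero_compl_closure_mirrorClass :
    Measure.dirac (0 : Torus.energySpace (Fin 3)) (closure mirrorClass)ᶜ = 0 := by
  rw [Measure.dirac_apply' _ isClosed_closure.measurableSet.compl, Set.indicator_of_notMem]
  exact fun h => h (subset_closure zero_mem_mirrorClass)

/-- **Any proof must use the stationary-statistical-solution clause**: the Dirac mass at rest (energy,
enstrophy, dissipation all `0`; mirror symmetric; a probability measure) kills the statement without it, at
every level `E ≥ 0` (here `E = 0`, `ν = ν₀/2`). -/
theorem mirrorStatisticsLoudTG_false_without_sss : ¬ MirrorStatisticsLoudTGWithoutSSS := by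
  intro h
  obtain ⟨ε₀, ν₀, hε, hν, hall⟩ := h 0
  have hI : Integrable (fun v : Torus.energySpace (Fin 3) => ‖v‖ ^ 2) (Measure.dirac (0 : Torus.energySpace (Fin 3))) :=
    (integrable_const (‖(0 : Torus.energySpace (Fin 3))‖ ^ 2)).congr (ae_eq_dirac (fun v : Torus.energySpace (Fin 3) => ‖v‖ ^ 2)).symm
  have hE : Torus.ensembleEnergy (Measure.dirac (0 : Torus.energySpace (Fin 3))) ≤ 0 := by
    unfold Torus.ensembleEnergy
    rw [integral_dirac]
    simp
  have key := hall (ν₀ / 2) (by positivity) (by linarith) _ inferInstance hI hE dirac_zero_compl_closure_mirrorClass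
  have hD : Torus.ensembleDissipation (ν₀ / 2) (Measure.dirac (0 : Torus.energySpace (Fin 3))) = 0 := by
    unfold Torus.ensembleDissipation
    rw [Summit.AnomalousDissipation.AnomalousDissipation.Theorems.GPStatisticalRigidity.Negative.ensembleEnstrophy_dirac_zero]
    simp
  rw [hD] at key
  exact absurd key (not_le.mpr hε)

/-! ## §6 Kill switch: quiet bounded mirror-symmetric steady states -/

/-- The Dirac mass at a point of the closed mirror class is K-supported. -/
theorem dirac_compl_closure_mirrorClass_of_mem {u : Torus.energySpace (Fin 3)} (hu : u ∈ closure mirrorClass) :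
    Measure.dirac u (closure mirrorClass)ᶜ = 0 := by
  rw [Measure.dirac_apply' _ isClosed_closure.measurableSet.compl, Set.indicator_of_notMem]
  exact fun h => h hu

/-- **Kill switch (steady states).** ONE sequence of steady weak solutions `uₙ ∈ V` of NS_{νₙ}(f_TG) in the
(closure of the) mirror class, along `νₙ → 0⁺`, with bounded energy `‖uₙ‖² ≤ E` and vanishing dissipation
`νₙ ‖∇uₙ‖² → 0`, refutes the crux: their Dirac masses are K-supported stationary statistical solutions
(FMRT 2001, Ch. IV §1.2; tree fact `isStationaryStatisticalSolution_dirac_holds`) of energy `≤ E` whose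
ensemble dissipation eventually drops below `ε₀(E)`. -/
theorem not_mirrorStatisticsLoudTG_of_quietSteadyStates {E : ℝ} (νs : ℕ → ℝ)
    (u : ℕ → Torus.energySpace (Fin 3)) (hν : ∀ n, 0 < νs n) (hν0 : Tendsto νs atTop (𝓝 0))
    (hV : ∀ n, ((u n : Lp (EuclideanSpace ℝ (Fin 3)) 2 (volume : Measure (UnitAddTorus (Fin 3))))) ∈
      Torus.energySpaceV (Fin 3))
    (hsteady : ∀ n, Torus.IsSteadyWeakSolution (νs n) tgForce (u n))
    (hK : ∀ n, u n ∈ closure mirrorClass) (hE : ∀ n, ‖u n‖ ^ 2 ≤ E)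
    (hquiet : Tendsto (fun n => νs n *
      (eGradNormSq (((u n : Lp (EuclideanSpace ℝ (Fin 3)) 2 (volume : Measure (UnitAddTorus (Fin 3))))) :
        UnitAddTorus (Fin 3) → EuclideanSpace ℝ (Fin 3))).toReal) atTop (𝓝 0)) :
    ¬ MirrorStatisticsLoudTG := by
  intro h
  obtain ⟨ε₀, ν₀, hε, hν₀, hl⟩ := (crux_iff.1 h) E
  -- eventually `νₙ < ν₀` and `νₙ ‖∇uₙ‖² < ε₀`
  have h1 : ∀ᶠ n in atTop, νs n < ν₀ := hν0.eventually (gt_mem_nhds hν₀)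
  have h2 : ∀ᶠ n in atTop, νs n * (eGradNormSq (((u n : Lp (EuclideanSpace ℝ (Fin 3)) 2
      (volume : Measure (UnitAddTorus (Fin 3))))) : UnitAddTorus (Fin 3) → EuclideanSpace ℝ (Fin 3))).toReal < ε₀ :=
    hquiet.eventually (gt_mem_nhds hε)
  obtain ⟨n, hn1, hn2⟩ := (h1.and h2).exists
  have hsss : Torus.IsStationaryStatisticalSolution (νs n) tgForce (Measure.dirac (u n)) :=
    Torus.isStationaryStatisticalSolution_dirac_holds (hν n).le memLp_tgForce (by simp) (hV n) (hsteady n)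
  have hI : Integrable (fun v : Torus.energySpace (Fin 3) => ‖v‖ ^ 2) (Measure.dirac (u n)) :=
    (integrable_const (‖u n‖ ^ 2)).congr (ae_eq_dirac (fun v : Torus.energySpace (Fin 3) => ‖v‖ ^ 2)).symm
  have hEn : Torus.ensembleEnergy (Measure.dirac (u n)) ≤ E := by
    unfold Torus.ensembleEnergy
    rw [integral_dirac]
    exact hE n
  have key := hl (νs n) (hν n) hn1 _ hsss hI hEn (dirac_compl_closure_mirrorClass_of_mem (hK n))
  have hD : Torus.ensembleDissipation (νs n) (Measure.dirac (u n)) = νs n *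
      (eGradNormSq (((u n : Lp (EuclideanSpace ℝ (Fin 3)) 2 (volume : Measure (UnitAddTorus (Fin 3))))) :
        UnitAddTorus (Fin 3) → EuclideanSpace ℝ (Fin 3))).toReal := by
    unfold Torus.ensembleDissipation Torus.ensembleEnstrophy
    rw [lintegral_dirac]
  rw [hD] at key
  exact absurd (key.trans_lt hn2) (lt_irrefl _)

end Summit.AnomalousDissipation.AnomalousDissipation.Theorems.MirrorStatisticsLoudTG.Negative
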